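import Literature.MathematicalPhysics.QuantumFieldTheory.ConformalBootstrap3D.PointKernelK57Data
import Literature.MathematicalPhysics.QuantumFieldTheory.ConformalBootstrap3D.PointKernelParts

/-!
# K57 certificate, kernel part file P14: one-cell head segments 151, 152 in level ranges

The head cells whose kernel evaluation exceeds one `decide` are one-cell segments of `hsegsK57`; each is
checked by `PCert.hPartSideOK` (side conditions) and `PCert.hPartOK` per level range `[n_lo, n_lo + count)`
against an integer claim, the claims summing to `≥ 0` (`PointKernel.partsOK`); soundness is
`PCert.hParts_sound` (`PointKernelParts`).  The part files `P1, P2, …` are mutually independent (each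
imports only the data file); the ranges of one cell may span several of them, and the per-cell
conclusions `hparts_i` / `hcell_i` of those cells are assembled in `PointKernelK57.lean`.
Estimated kernel time 202 s.
-/

set_option maxRecDepth 100000
set_option maxHeartbeats 0

namespace Literature.MathematicalPhysics.QuantumFieldTheory.ConformalBootstrap3D.PointKernelK57

open Literature.MathematicalPhysics.QuantumFieldTheory.ConformalBootstrap3D.PointKernel

/-- levels `[41, 47)` of segment 151: partial lower sum `≥` claim. [folklore] -/
theorem part_151_3 : certK57.hPartOK (PCert.segAt hsegsK57 151) JHK57 41 6 (1182143033790031536214932876986535489) = true := by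
  decide +kernel

/-- levels `[47, 52)` of segment 151: partial lower sum `≥` claim. [folklore] -/
theorem part_151_4 : certK57.hPartOK (PCert.segAt hsegsK57 151) JHK57 47 5 (513963171040026849992155595744646031) = true := by
  decide +kernel

/-- levels `[52, 56)` of segment 151: partial lower sum `≥` claim. [folklore] -/
theorem part_151_5 : certK57.hPartOK (PCert.segAt hsegsK57 151) JHK57 52 4 (233641683635729581573493849702188609) = true := by
  decide +kernel

/-- levels `[56, 57)` of segment 151: partial lower sum `≥` claim. [folklore] -/
theorem part_151_6 : certK57.hPartOK (PCert.segAt hsegsK57 151) JHK57 56 1 (26758040965909167998499545922520210) = true := by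
  decide +kernel

/-- one-cell segment 152 (row 6, cell `[1795/256, 449/64]`, chord, `n_F = 48`,
4 level ranges): side conditions. [folklore] -/
theorem pside_152 : certK57.hPartSideOK (PCert.segAt hsegsK57 152) JHK57 = true := by
  decide +kernel

/-- its level ranges `(n_lo, count, claim)`. [folklore] -/
def parts_152 : List (ℕ × ℕ × ℤ) := [(0, 26, -10617676240923719509778992394707783310), (26, 11, 8100924476996262562938649712863036310), (37, 8, 2111538703683244416702970861998609889), (45, 4, 405213060244212530137371819846137112)]

/-- the ranges tile `[0, n_F]` and the claims sum to `≥ 0`. [folklore] -/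
theorem pcov_152 : PointKernel.partsOK 48 parts_152 = true := by
  decide +kernel

end Literature.MathematicalPhysics.QuantumFieldTheory.ConformalBootstrap3D.PointKernelK57
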